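import Summits.QuantumFields.YangMills.Theorems.DiagonalMirrorRPRWilsonDiagonalModelNatKernelL2

/-!
# Crux `DiagonalMirrorRPR` (stmt-QuantumFields-10604), line `sign-twisted-diagonal-trace`, construction F1_diag
# (director-ym O4 WORD 3 (A)), S4e₂: the bounded reweighted kernel `𝔟 = 𝔞/(√w ⊗ √w)` on the FINITE measure `(w·counting) ⊗ halfHaar`

Helper for the crux `DiagonalMirrorRPR` of `YangMills` (routes `IsotropyFromPowerCounting`, `MirrorModularBoosts`,
`PencilRigidity`; item stmt-QuantumFields-10604), attached `--supports … --as helper`; it closes nothing by itself.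

The lifted kernel `𝔞 = natKernel ρ β` of the Wilson diagonal two-step transfer matrix lives on the σ-finite, infinite
measure space `(ℕ × HalfCfg, counting ⊗ halfHaar)`, where the tree's spectral trace package
(`Literature/Analysis/OperatorTheory/PositiveKernel{TransferOperator,SpectralTrace,SpectralTraceTwo}`: bounded symmetric
kernel on a FINITE measure space ⇒ compact self-adjoint operator, eigenbasis, `Σ λᵢ^{M+2} =` cyclic integrals) does not apply
verbatim.  The cure is a change of reference measure that costs nothing spectrally: with the summable weights
`w_k = ψ_k(M⃗)² + 2^{-(k+1)}` (`M ≥ sup |w(Y)_j|`, so `ψ_k(w(Y))² ≤ w_k`) the kernel `𝔟 = 𝔞/(√w_k √w_{k′})` is BOUNDED,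
symmetric and strongly measurable on the finite measure `μ̃ = (w·counting) ⊗ halfHaar`, its integral operator on `L²(μ̃)` is
unitarily equivalent (`f ↦ f/√w`) to that of `𝔞`, and — all that is used downstream — its cyclic integrals over `μ̃^{⊗n}` are
the cyclic integrals of `𝔞`:

* `featWeight`, `featWeight_pos`, `hasSum_featWeight`, `abs_natFeature_le_natFeature_const`, `natFeature_sq_le_featWeight`,
  `abs_natFeature_le_sqrt_featWeight` — the weights;
* `wMeasure`, `wMeasure_singleton`, `isFiniteMeasure_wMeasure`, `tMeasure`, `isFiniteMeasure_tMeasure` — the finite measure;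
* `bKernel`, `bKernel_symm`, `stronglyMeasurable_bKernel`, `exists_abs_bKernel_le` — the bounded symmetric kernel;
* `prod_sqrt_featWeight_mul`, `prod_bKernel_eq`, `measurable_prod_bKernel_section`, `exists_abs_prod_bKernel_le`,
  ★ **`integral_cyclic_bKernel_eq`** — `∫ ∏_t 𝔟(V t, V (t+1)) dμ̃^{⊗n} = Σ'_{k ∈ ℕ^n} ∫_X ∏_t 𝔞((k_t,X_t),(k_{t+1},X_{t+1})) d(halfHaar)^{⊗n}`.

NEXT (S4e₃, file `…SpectralTrace`): operator + eigenbasis of `𝔟` from the tree package, `hasSum_pow_integral_cyclic_signed`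
(`…SignedTrace`) and `diagCyclicTraceU_eq_tsum_integral_natKernel` (`…ChainKernel`) ⇒ `Σᵢ λᵢ^{M+2} = diagCyclicTraceU ρ β (M+2)`.
HONEST FRAMING: construction helper; no `def wilsonDiagonalModel`; nothing about D_old ⟨10604⟩, the RP crux of the FOLD
restate, or the summit is proved; the Yang–Mills mass gap is NOT proved here or anywhere in the tree.
-/

set_option autoImplicit false

noncomputable section

open scoped BigOperators ENNReal
open MeasureTheory Function
open Literature.MathematicalPhysics.QuantumLattice Literature.MathematicalPhysics.QuantumFieldTheory
open Summit.QuantumFields.YangMills.Cruxes.DiagonalMirrorRPR.ParityBridgeColdTraces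

namespace Summit.QuantumFields.YangMills.Cruxes.DiagonalMirrorRPR.SignTwistedDiagonalTrace.WilsonDiagonal

/-! ## §30 Reweighting: the bounded kernel `𝔟 = 𝔞/(√w ⊗ √w)` on the finite measure `(w · counting) ⊗ halfHaar` -/

section Weights

variable {p : ℕ}

/-- The weights `w_k = ψ_k(M⃗)² + 2^{-(k+1)} > 0` (`M⃗` the constant vector `M`): summable (`Σ_k ψ_k(M⃗)² = e^{β p M²}`)
and dominating every squared feature, `ψ_k(w)² ≤ w_k` whenever `|w_j| ≤ M`. -/
def featWeight (p : ℕ) (β M : ℝ) (k : ℕ) : ℝ :=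
  natFeature (p := p) β k (fun _ => M) ^ 2 + (1 / 2) ^ (k + 1)

/-- `w_k > 0`. -/
theorem featWeight_pos (p : ℕ) (β M : ℝ) (k : ℕ) : 0 < featWeight p β M k :=
  add_pos_of_nonneg_of_pos (sq_nonneg _) (by positivity)

/-- `Σ_k w_k = e^{β Σ_j M²} + 1` (`β ≥ 0`). -/
theorem hasSum_featWeight (p : ℕ) {β : ℝ} (hβ : 0 ≤ β) (M : ℝ) :
    HasSum (featWeight p β M) (Real.exp (β * ∑ _j : Fin p, M ^ 2) + 1) := by
  have h1 := hasSum_natFeature_sq (p := p) hβ (fun _ => M)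
  have h2 : HasSum (fun k : ℕ => (1 / 2 : ℝ) ^ (k + 1)) 1 := by
    have h := hasSum_geometric_two' (1 : ℝ)
    have he : (fun k : ℕ => (1 / 2 : ℝ) ^ (k + 1)) = fun k => (1 : ℝ) / 2 / 2 ^ k := by
      funext k
      rw [one_div_pow, pow_succ', div_div]
    rw [he]
    exact h
  exact h1.add h2

/-- `|ψ_k(w)| ≤ ψ_k(M⃗)` whenever `|w_j| ≤ M` for all `j`. -/
theorem abs_natFeature_le_natFeature_const (β : ℝ) (k : ℕ) {w : Fin p → ℝ} {M : ℝ} (hM : ∀ j, |w j| ≤ M) :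
    |natFeature (p := p) β k w| ≤ natFeature (p := p) β k (fun _ => M) := by
  by_cases hk : ∃ q, idxEmb p q = k
  · obtain ⟨q, rfl⟩ := hk
    rw [natFeature_idxEmb, natFeature_idxEmb]
    calc |expFeature β q w| ≤ Real.sqrt (β ^ q.1 / (q.1.factorial : ℝ)) * M ^ q.1 := abs_expFeature_le q hM
      _ = expFeature β q (fun _ => M) := by
          simp only [expFeature, Finset.prod_const, Finset.card_univ, Fintype.card_fin]
  · rw [natFeature_of_not_exists β hk, natFeature_of_not_exists β hk, abs_zero]

/-- `ψ_k(w)² ≤ w_k` whenever `|w_j| ≤ M`. -/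
theorem natFeature_sq_le_featWeight (β : ℝ) (k : ℕ) {w : Fin p → ℝ} {M : ℝ} (hM : ∀ j, |w j| ≤ M) :
    natFeature (p := p) β k w ^ 2 ≤ featWeight p β M k := by
  have h := abs_natFeature_le_natFeature_const β k hM
  calc natFeature (p := p) β k w ^ 2 = |natFeature (p := p) β k w| ^ 2 := (sq_abs _).symm
    _ ≤ natFeature (p := p) β k (fun _ => M) ^ 2 := pow_le_pow_left₀ (abs_nonneg _) h 2
    _ ≤ featWeight p β M k := le_add_of_nonneg_right (by positivity)

/-- `|ψ_k(w)| ≤ √w_k` whenever `|w_j| ≤ M`. -/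
theorem abs_natFeature_le_sqrt_featWeight (β : ℝ) (k : ℕ) {w : Fin p → ℝ} {M : ℝ} (hM : ∀ j, |w j| ≤ M) :
    |natFeature (p := p) β k w| ≤ Real.sqrt (featWeight p β M k) :=
  Real.abs_le_sqrt (natFeature_sq_le_featWeight β k hM)

/-- The finite measure `w · counting` on `ℕ`. -/
def wMeasure (p : ℕ) (β M : ℝ) : Measure ℕ :=
  Measure.count.withDensity fun k => ENNReal.ofReal (featWeight p β M k)

/-- Its atoms: `(w · counting){k} = w_k`. -/
theorem wMeasure_singleton (p : ℕ) (β M : ℝ) (k : ℕ) :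
    wMeasure p β M {k} = ENNReal.ofReal (featWeight p β M k) := by
  rw [wMeasure, withDensity_apply _ (measurableSet_singleton k), lintegral_singleton, Measure.count_singleton, mul_one]

/-- `w · counting` is a finite measure (`β ≥ 0`). -/
theorem isFiniteMeasure_wMeasure (p : ℕ) {β : ℝ} (hβ : 0 ≤ β) (M : ℝ) : IsFiniteMeasure (wMeasure p β M) := by
  refine isFiniteMeasure_withDensity ?_
  rw [lintegral_count, ← ENNReal.ofReal_tsum_of_nonneg (fun k => (featWeight_pos p β M k).le)
    (hasSum_featWeight p hβ M).summable]
  exact ENNReal.ofReal_ne_top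

end Weights

section Reweight

variable {S : ℕ} [NeZero S] {G : Type} [Group G] {Nc : ℕ} (ρ : G →* Matrix (Fin Nc) (Fin Nc) ℂ)
variable [TopologicalSpace G] [IsTopologicalGroup G] [CompactSpace G] [MeasurableSpace G] [BorelSpace G]
  [SecondCountableTopology G]

variable (S G Nc) in
/-- The finite reweighted measure `μ̃ = (w · counting) ⊗ halfHaar` on `ℕ × HalfCfg`. -/
def tMeasure (β M : ℝ) : Measure (ℕ × HalfCfg S S G) := (wMeasure (featDim S Nc) β M).prod (halfHaar S G)

omit [SecondCountableTopology G] in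
/-- `μ̃` is finite (`β ≥ 0`). -/
theorem isFiniteMeasure_tMeasure {β : ℝ} (hβ : 0 ≤ β) (M : ℝ) : IsFiniteMeasure (tMeasure S G Nc β M) := by
  haveI := isFiniteMeasure_wMeasure (featDim S Nc) hβ M
  haveI : IsFiniteMeasure (halfHaar S G) := by unfold halfHaar; infer_instance
  unfold tMeasure; infer_instance

/-- **The reweighted kernel** `𝔟((k,X),(k′,X′)) = 𝔞((k,X),(k′,X′)) / (√w_k √w_{k′})` — unitarily equivalent data: the
integral operator of `𝔟` on `L²(μ̃)` is conjugate to that of `𝔞` on `L²(counting ⊗ halfHaar)` under `f ↦ f/√w`; here only its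
cyclic integrals are compared (`…ReweightCyclic`). -/
def bKernel (β M : ℝ) (a b : ℕ × HalfCfg S S G) : ℝ :=
  natKernel ρ β a b / (Real.sqrt (featWeight (featDim S Nc) β M a.1) * Real.sqrt (featWeight (featDim S Nc) β M b.1))

omit [SecondCountableTopology G] in
/-- `𝔟` is symmetric. -/
theorem bKernel_symm (β M : ℝ) (a b : ℕ × HalfCfg S S G) : bKernel ρ β M a b = bKernel ρ β M b a := by
  unfold bKernel
  rw [natKernel_symm ρ β a b, mul_comm (Real.sqrt _) (Real.sqrt _)]

/-- `𝔟` is jointly (strongly) measurable. -/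
theorem stronglyMeasurable_bKernel (hρ : Continuous ρ) (β M : ℝ) : StronglyMeasurable (uncurry (bKernel (S := S) ρ β M)) := by
  have h1 : Measurable fun z : (ℕ × HalfCfg S S G) × (ℕ × HalfCfg S S G) => natKernel ρ β z.1 z.2 :=
    measurable_natKernel ρ hρ β
  have hw : Measurable fun k : ℕ => Real.sqrt (featWeight (featDim S Nc) β M k) := measurable_from_nat
  have h2 : Measurable fun z : (ℕ × HalfCfg S S G) × (ℕ × HalfCfg S S G) =>
      Real.sqrt (featWeight (featDim S Nc) β M z.1.1) * Real.sqrt (featWeight (featDim S Nc) β M z.2.1) :=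
    (hw.comp (measurable_fst.comp measurable_fst)).mul (hw.comp (measurable_fst.comp measurable_snd))
  exact (h1.div h2).stronglyMeasurable

/-- **`𝔟` is bounded**: `|𝔟| ≤ C` with the constant of `exists_abs_natKernel_le`, because `|ψ_k(w(Y))| ≤ √w_k`
(`|w(Y)_j| ≤ M`) and `halfHaar` is a probability measure. -/
theorem exists_abs_bKernel_le (hρ : Continuous ρ) (β : ℝ) {M : ℝ}
    (hM : ∀ (Y : HalfCfg S S G) (j : Fin (featDim S Nc)), |bondVec ρ Y j| ≤ M) :
    ∃ C : ℝ, ∀ a b : ℕ × HalfCfg S S G, ‖bKernel ρ β M a b‖ ≤ C := by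
  obtain ⟨C, hC0, hC⟩ := exists_abs_natKernel_le (S := S) ρ hρ β
  haveI : IsProbabilityMeasure (halfHaar S G) := by unfold halfHaar; infer_instance
  refine ⟨C, fun a b => ?_⟩
  have hwa := featWeight_pos (featDim S Nc) β M a.1
  have hwb := featWeight_pos (featDim S Nc) β M b.1
  have hsq : 0 < Real.sqrt (featWeight (featDim S Nc) β M a.1) * Real.sqrt (featWeight (featDim S Nc) β M b.1) :=
    mul_pos (Real.sqrt_pos.2 hwa) (Real.sqrt_pos.2 hwb)
  rw [Real.norm_eq_abs, bKernel, abs_div, abs_of_pos hsq, div_le_iff₀ hsq]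
  calc |natKernel ρ β a b|
      ≤ C * ∫ Y, |natFeature (p := featDim S Nc) β a.1 (bondVec ρ (thetaHalf Y))| *
          |natFeature (p := featDim S Nc) β b.1 (bondVec ρ Y)| ∂(halfHaar S G) := hC a b
    _ ≤ C * ∫ _Y : HalfCfg S S G, Real.sqrt (featWeight (featDim S Nc) β M a.1) *
          Real.sqrt (featWeight (featDim S Nc) β M b.1) ∂(halfHaar S G) := by
        refine mul_le_mul_of_nonneg_left ?_ hC0.le
        refine integral_mono_of_nonneg (ae_of_all _ fun Y => mul_nonneg (abs_nonneg _) (abs_nonneg _)) (integrable_const _)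
          (ae_of_all _ fun Y => ?_)
        exact mul_le_mul (abs_natFeature_le_sqrt_featWeight β a.1 fun j => hM _ j)
          (abs_natFeature_le_sqrt_featWeight β b.1 fun j => hM _ j) (abs_nonneg _) (Real.sqrt_nonneg _)
    _ = C * (Real.sqrt (featWeight (featDim S Nc) β M a.1) * Real.sqrt (featWeight (featDim S Nc) β M b.1)) := by
        rw [integral_const, smul_eq_mul, probReal_univ, one_mul]

end Reweight


section ReweightCyclic

variable {S : ℕ} [NeZero S] {G : Type} [Group G] {Nc : ℕ} (ρ : G →* Matrix (Fin Nc) (Fin Nc) ℂ)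
variable [TopologicalSpace G] [IsTopologicalGroup G] [CompactSpace G] [MeasurableSpace G] [BorelSpace G]
  [SecondCountableTopology G]

/-- Around a cycle the weight prefactors of `𝔟` recombine: `∏_t √w_{k_t} √w_{k_{t+1}} = ∏_t w_{k_t}`. -/
theorem prod_sqrt_featWeight_mul (p : ℕ) (β M : ℝ) {n : ℕ} [NeZero n] (k : Fin n → ℕ) :
    ∏ t, (Real.sqrt (featWeight p β M (k t)) * Real.sqrt (featWeight p β M (k (t + 1)))) =
      ∏ t, featWeight p β M (k t) := by
  rw [Finset.prod_mul_distrib]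
  have h : ∏ t, Real.sqrt (featWeight p β M (k (t + 1))) = ∏ t, Real.sqrt (featWeight p β M (k t)) :=
    Fintype.prod_equiv (Equiv.addRight 1) _ _ fun t => rfl
  rw [h, ← Finset.prod_mul_distrib]
  exact Finset.prod_congr rfl fun t _ => Real.mul_self_sqrt (featWeight_pos p β M _).le

omit [SecondCountableTopology G] in
/-- The cyclic product of `𝔟`'s is the cyclic product of `𝔞`'s divided by `∏_t w_{k_t}`. -/
theorem prod_bKernel_eq (β M : ℝ) {n : ℕ} [NeZero n] (k : Fin n → ℕ) (X : Fin n → HalfCfg S S G) :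
    ∏ t, bKernel ρ β M (k t, X t) (k (t + 1), X (t + 1)) =
      (∏ t, natKernel ρ β (k t, X t) (k (t + 1), X (t + 1))) / ∏ t, featWeight (featDim S Nc) β M (k t) := by
  simp only [bKernel]
  rw [Finset.prod_div_distrib, prod_sqrt_featWeight_mul]

/-- For a fixed discrete path `k`, the cyclic product of `𝔟`'s is measurable in the continuous path `X` (continuity of
`𝔞((k,·),(k′,·))`). -/
theorem measurable_prod_bKernel_section (hρ : Continuous ρ) (β M : ℝ) {n : ℕ} [NeZero n] (k : Fin n → ℕ) :
    Measurable fun X : Fin n → HalfCfg S S G => ∏ t, bKernel ρ β M (k t, X t) (k (t + 1), X (t + 1)) := by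
  simp only [bKernel]
  refine Finset.measurable_prod _ fun t _ => ?_
  refine Measurable.div ?_ measurable_const
  have h := (continuous_natKernel (S := S) ρ hρ β (k t) (k (t + 1))).measurable
  simpa only [Function.comp_def] using
    h.comp ((measurable_pi_apply (X := fun _ : Fin n => HalfCfg S S G) t).prodMk
      (measurable_pi_apply (X := fun _ : Fin n => HalfCfg S S G) (t + 1)))

/-- The cyclic product of `𝔟`'s is bounded by `C^n`. -/
theorem exists_abs_prod_bKernel_le (hρ : Continuous ρ) (β : ℝ) {M : ℝ}
    (hM : ∀ (Y : HalfCfg S S G) (j : Fin (featDim S Nc)), |bondVec ρ Y j| ≤ M) (n : ℕ) [NeZero n] :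
    ∃ B : ℝ, ∀ (k : Fin n → ℕ) (X : Fin n → HalfCfg S S G),
      ‖∏ t, bKernel ρ β M (k t, X t) (k (t + 1), X (t + 1))‖ ≤ B := by
  obtain ⟨C, hC⟩ := exists_abs_bKernel_le ρ hρ β hM
  refine ⟨C ^ n, fun k X => ?_⟩
  rw [Real.norm_eq_abs, Finset.abs_prod]
  calc ∏ t, |bKernel ρ β M (k t, X t) (k (t + 1), X (t + 1))| ≤ ∏ _t : Fin n, C :=
        Finset.prod_le_prod (fun t _ => abs_nonneg _) fun t _ => by
          simpa only [Real.norm_eq_abs] using hC (k t, X t) (k (t + 1), X (t + 1))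
    _ = C ^ n := by rw [Finset.prod_const, Finset.card_univ, Fintype.card_fin]

/-- ★ **The cyclic integrals of `𝔟` over `μ̃^{⊗n}` are the cyclic "integrals" of `𝔞` over `(counting ⊗ halfHaar)^{⊗n}`**:
`∫ ∏_t 𝔟(V t, V (t+1)) dμ̃^{⊗n}(V) = Σ'_{k ∈ ℕ^n} ∫_X ∏_t 𝔞((k_t, X_t), (k_{t+1}, X_{t+1})) d(halfHaar)^{⊗n}` — zip
`V = (k, X)` (`measurePreserving_arrowProdEquivProdArrow`), Fubini (bounded measurable integrand, finite measure), the
discrete factor is a weighted sum (`integral_countable`, `Measure.pi_singleton`) whose weights `∏_t w_{k_t}` cancel the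
prefactors of `𝔟` (`prod_bKernel_eq`). -/
theorem integral_cyclic_bKernel_eq (hρ : Continuous ρ) {β : ℝ} (hβ : 0 ≤ β) {M : ℝ}
    (hM : ∀ (Y : HalfCfg S S G) (j : Fin (featDim S Nc)), |bondVec ρ Y j| ≤ M) (n : ℕ) [NeZero n] :
    ∫ V : Fin n → ℕ × HalfCfg S S G, ∏ t, bKernel ρ β M (V t) (V (t + 1)) ∂(Measure.pi fun _ => tMeasure S G Nc β M) =
      ∑' k : Fin n → ℕ, ∫ X : Fin n → HalfCfg S S G, ∏ t, natKernel ρ β (k t, X t) (k (t + 1), X (t + 1))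
        ∂(Measure.pi fun _ => halfHaar S G) := by
  haveI := isFiniteMeasure_wMeasure (featDim S Nc) hβ M
  haveI : IsFiniteMeasure (halfHaar S G) := by unfold halfHaar; infer_instance
  obtain ⟨B, hB⟩ := exists_abs_prod_bKernel_le ρ hρ β hM n
  have hmp := measurePreserving_arrowProdEquivProdArrow ℕ (HalfCfg S S G) (Fin n)
    (fun _ => wMeasure (featDim S Nc) β M) (fun _ => halfHaar S G)
  have step1 : ∫ V : Fin n → ℕ × HalfCfg S S G, ∏ t, bKernel ρ β M (V t) (V (t + 1))
        ∂(Measure.pi fun _ => tMeasure S G Nc β M) =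
      ∫ q : (Fin n → ℕ) × (Fin n → HalfCfg S S G), ∏ t, bKernel ρ β M (q.1 t, q.2 t) (q.1 (t + 1), q.2 (t + 1))
        ∂((Measure.pi fun _ => wMeasure (featDim S Nc) β M).prod (Measure.pi fun _ => halfHaar S G)) :=
    ((hmp.symm _).integral_comp'
      (fun V : Fin n → ℕ × HalfCfg S S G => ∏ t, bKernel ρ β M (V t) (V (t + 1)))).symm
  have hm : Measurable fun q : (Fin n → ℕ) × (Fin n → HalfCfg S S G) =>
      ∏ t, bKernel ρ β M (q.1 t, q.2 t) (q.1 (t + 1), q.2 (t + 1)) :=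
    measurable_from_prod_countable_right fun k => measurable_prod_bKernel_section ρ hρ β M k
  have hf : Integrable (fun q : (Fin n → ℕ) × (Fin n → HalfCfg S S G) =>
      ∏ t, bKernel ρ β M (q.1 t, q.2 t) (q.1 (t + 1), q.2 (t + 1)))
      ((Measure.pi fun _ => wMeasure (featDim S Nc) β M).prod (Measure.pi fun _ => halfHaar S G)) :=
    Integrable.of_bound hm.aestronglyMeasurable B (ae_of_all _ fun q => hB q.1 q.2)
  rw [step1, integral_prod _ hf, integral_countable hf.integral_prod_left]
  refine tsum_congr fun k => ?_
  have hne : ∏ t, featWeight (featDim S Nc) β M (k t) ≠ 0 :=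
    (Finset.prod_pos fun t _ => featWeight_pos _ β M (k t)).ne'
  rw [measureReal_def, Measure.pi_singleton, ENNReal.toReal_prod]
  simp only [wMeasure_singleton, ENNReal.toReal_ofReal (featWeight_pos _ _ _ _).le]
  simp_rw [prod_bKernel_eq]
  rw [integral_div, smul_eq_mul, mul_comm]
  exact div_mul_cancel₀ _ hne

end ReweightCyclic

end Summit.QuantumFields.YangMills.Cruxes.DiagonalMirrorRPR.SignTwistedDiagonalTrace.WilsonDiagonal

end
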